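import Literature.Barriers.CriticalPhenomena.WeaklySAWSusceptibilityLowerBound
import Literature.Barriers.CriticalPhenomena.WeaklySAWCriticalNuLowerBound
import Literature.Probability.LatticeModels.SRWReturnCounts
import HarnessLib

/-!
# The continuous-time weakly self-avoiding walk: the grand-canonical (time-integrated)
# representation of the susceptibility over step sequences

Companion to `WeaklySAWFourDimLogCorrections.lean` (definitions `pathIntegral`, `survival = c_T`,
`susceptibility = χ(g,ν)`, `greenZero = C₀(0)`; namespace
`Literature.Barriers.CriticalPhenomena.CTWSAW`) and to the sojourn-simplex calculus of
`WeaklySAWSojournSimplex.lean` (`lintegral_Ioi_lintegral_sojournSet`: `(T, s) ↦ sojourns T s` is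
volume preserving from `{T > 0} × Δ_k(T)` onto `(0,∞)^{k+1}`). Source: Bauerschmidt–Brydges–Slade,
CMP 337 (2015), arXiv:1403.7422, §1.1 (the model) and Appendix A.

Integrating the defining formula `χ(g,ν) = ∫₀^∞ c_T e^{-νT} dT` over the total time `T` turns the
jump-chain representation (Poisson number of jumps, sojourns uniform on the simplex) into a sum
over `k`-step skeletons with FREE sojourns `σ ∈ (0,∞)^{k+1}` weighted by `e^{-(2d+ν) Σ σ}`:

* `freeSelfInt m v σ = Σ_{i,j ≤ m} σᵢ σⱼ 𝟙{v i = v j}` — the self-intersection local time of a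
  skeleton with vertex sequence `v` and free sojourns `σ`;
* `gcIntegrand g λ m v σ = exp(-g·freeSelfInt - λ Σσ)` and
  `gcTerm g λ m v = ∫_{(0,∞)^{m+1}} gcIntegrand dσ`;
* `lintegral_Ioi_pathIntegral_eq_gcTerm` — per skeleton,
  `∫₀^∞ e^{-2dT} (∫_{Δ(T)} e^{-gI}) e^{-νT} dT = gcTerm g (2d+ν) |ω| ω(·)`;
* **`susceptibility_eq_tsum_stepSeq`** —
  `χ(g,ν) = Σ_k Σ_{e : StepSeq d k} gcTerm g (2d+ν) k (pos e)` (the walks of `zdGraph d` from `0`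
  re-indexed by step sequences through `Literature.Probability.LatticeModels.SRW.sum_walks_eq_sum_stepSeq`);
* the Green-function link in `SRW.prob` form — `lintegral_weightedExpectation_zero_indicator`
  (`∫₀^∞ P(X_T = 0) dT = Σ_k p_k(0)/(2d)`, `p_k = SRW.prob d k`), `greenZero_eq_of_summable` /
  `greenZero_eq_tsum_prob` (`C₀(0) = G/(2d)`, `G = Σ_k P(S_k = 0)`, `d ≥ 3`) and
  `summable_srw_prob_zero` — all three SHORT COROLLARIES of results already in the tree:
  `greenLintegral_eq_greenSeries`, `greenSeries_eq_ofReal_tsum`, `greenZero_eq_toReal`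
  (`WeaklySAWCriticalNuLowerBound.lean`, `closedWords` form) and `summable_prob_zero`
  (`WeaklySAWReturnProbability.lean`, `card (finsetWalkLength n 0 0)/(2d)^n` form), transported along
  `SRW.card_finsetWalkLength_eq_count`; nothing about the Green function is re-proved here.

All statements are identities between `ℝ≥0∞`-valued integrals, valid for every `g ≥ 0`
(resp. `g = 0`) and every `ν`; fully proved. [folklore] identities around
[cite: BauerschmidtBrydgesSlade2015LogCorr, §1.1 and Appendix A].
-/

noncomputable section

open MeasureTheory Set Filter Literature.Probability.LatticeModels
open scoped ENNReal BigOperators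

namespace Literature.Barriers.CriticalPhenomena.CTWSAW

variable {d : ℕ}

/-! ### Free-sojourn functionals of a skeleton -/

/-- The self-intersection local time of a skeleton with vertex sequence `v : ℕ → ℤ^d` (only
`v 0, …, v m` are used) and free sojourn times `σ ∈ ℝ^{m+1}`:
`Σ_{i,j ≤ m} σᵢ σⱼ 𝟙{v i = v j}`. For `σ = sojourns T s` and `v = ω.getVert` this is
`selfIntersection T ω s`. [cite: BauerschmidtBrydgesSlade2015LogCorr, §1.1 (intersection local time)] -/
def freeSelfInt (m : ℕ) (v : ℕ → Site d) (σ : Fin (m + 1) → ℝ) : ℝ :=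
  ∑ i : Fin (m + 1), ∑ j : Fin (m + 1), if v i = v j then σ i * σ j else 0

/-- The grand-canonical integrand `exp(-g Σ_{i,j} σᵢσⱼ𝟙{vᵢ = vⱼ} - λ Σᵢ σᵢ)` of a skeleton with
vertices `v` and free sojourns `σ ∈ ℝ^{m+1}`. [folklore] -/
def gcIntegrand (g lam : ℝ) (m : ℕ) (v : ℕ → Site d) (σ : Fin (m + 1) → ℝ) : ℝ≥0∞ :=
  ENNReal.ofReal (Real.exp (-g * freeSelfInt m v σ - lam * ∑ i, σ i))

/-- The time-integrated (grand-canonical) weight of a skeleton: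
`gcTerm g λ m v = ∫_{(0,∞)^{m+1}} exp(-g Σ_{i,j} σᵢσⱼ𝟙{vᵢ = vⱼ} - λ Σᵢ σᵢ) dσ`, the integral of
`gcIntegrand` over the open orthant. [cite: BauerschmidtBrydgesSlade2015LogCorr, §1.1 and Appendix A] -/
def gcTerm (g lam : ℝ) (m : ℕ) (v : ℕ → Site d) : ℝ≥0∞ :=
  ∫⁻ σ in Set.pi univ (fun _ => Ioi (0 : ℝ)), gcIntegrand g lam m v σ

/-- `freeSelfInt` is continuous in the sojourns. [folklore] -/
theorem continuous_freeSelfInt (m : ℕ) (v : ℕ → Site d) : Continuous (freeSelfInt m v) := by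
  unfold freeSelfInt
  refine continuous_finsetSum _ fun i _ => continuous_finsetSum _ fun j _ => ?_
  split_ifs
  · exact (continuous_apply i).mul (continuous_apply j)
  · exact continuous_const

/-- The integrand of `gcTerm` is measurable. [folklore] -/
theorem measurable_gcIntegrand (g lam : ℝ) (m : ℕ) (v : ℕ → Site d) :
    Measurable (gcIntegrand g lam m v) := by
  unfold gcIntegrand
  refine ENNReal.measurable_ofReal.comp (Real.measurable_exp.comp ?_)
  exact ((measurable_const.mul (continuous_freeSelfInt m v).measurable).sub
    (measurable_const.mul (Finset.measurable_sum _ fun i _ => measurable_pi_apply i)))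

/-- Unfolding lemma for `gcTerm`. [folklore] -/
theorem gcTerm_eq (g lam : ℝ) (m : ℕ) (v : ℕ → Site d) :
    gcTerm g lam m v = ∫⁻ σ in Set.pi univ (fun _ => Ioi (0 : ℝ)), gcIntegrand g lam m v σ := rfl

/-- The self-intersection local time of the jump-chain representation is `freeSelfInt` evaluated
at the sojourns. [folklore] -/
theorem selfIntersection_eq_freeSelfInt (T : ℝ) {x : Site d} (ω : (zdGraph d).Walk 0 x)
    (s : Fin ω.length → ℝ) :
    selfIntersection T ω s = freeSelfInt ω.length (fun i => ω.getVert i) (sojourns T s) := rfl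

/-! ### Integrating the path integral over the total time -/

/-- **Per-skeleton grand-canonical identity**:
`∫₀^∞ e^{-2dT} (∫_{Δ_{|ω|}(T)} e^{-gI(T)} ds) e^{-νT} dT = gcTerm g (2d+ν) |ω| ω(·)` — the Poisson
factor and the killing factor distribute over the sojourns (`Σ sojourns = T`) and `(T,s) ↦ sojourns`
is volume preserving onto the open orthant. [cite: BauerschmidtBrydgesSlade2015LogCorr, Appendix A (proof of Lemma A.1)] -/
theorem lintegral_Ioi_pathIntegral_eq_gcTerm (g ν : ℝ) {x : Site d} (ω : (zdGraph d).Walk 0 x) :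
    ∫⁻ T in Ioi 0, ENNReal.ofReal (Real.exp (-(2 * d) * T)) * pathIntegral g T ω *
        ENNReal.ofReal (Real.exp (-ν * T)) =
      gcTerm g (2 * d + ν) ω.length (fun i => ω.getVert i) := by
  have hH := measurable_gcIntegrand g (2 * d + ν) ω.length (fun i => ω.getVert i)
  rw [gcTerm_eq, ← lintegral_Ioi_lintegral_sojournSet hH]
  refine setLIntegral_congr_fun measurableSet_Ioi fun T _ => ?_
  unfold pathIntegral
  rw [← lintegral_const_mul' _ _ ENNReal.ofReal_ne_top, ← lintegral_mul_const' _ _ ENNReal.ofReal_ne_top]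
  refine setLIntegral_congr_fun (measurableSet_sojournSet _ _) fun s _ => ?_
  unfold gcIntegrand
  rw [← ENNReal.ofReal_mul (Real.exp_pos _).le, ← ENNReal.ofReal_mul (by positivity),
    ← Real.exp_add, ← Real.exp_add, selfIntersection_eq_freeSelfInt, sum_sojourns]
  congr 2
  ring

/-- Measurability in `T` of the time-weighted path integral. [folklore] -/
theorem measurable_pathIntegral_weighted (g ν : ℝ) {x : Site d} (ω : (zdGraph d).Walk 0 x) :
    Measurable fun T : ℝ => ENNReal.ofReal (Real.exp (-(2 * d) * T)) * pathIntegral g T ω *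
      ENNReal.ofReal (Real.exp (-ν * T)) := by
  have hpi : Measurable fun T : ℝ => pathIntegral g T ω := by
    have h := measurable_lintegral_sojournSet (n := ω.length)
      (H := fun σ => ENNReal.ofReal (Real.exp (-g * freeSelfInt ω.length (fun i => ω.getVert i) σ)))
      (ENNReal.measurable_ofReal.comp (Real.measurable_exp.comp
        (measurable_const.mul (continuous_freeSelfInt _ _).measurable)))
    exact h
  exact ((ENNReal.measurable_ofReal.comp (Real.measurable_exp.comp
    (measurable_const.mul measurable_id))).mul hpi).mul
    (ENNReal.measurable_ofReal.comp (Real.measurable_exp.comp (measurable_const.mul measurable_id)))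

/-- **The susceptibility, time-integrated, over graph walks**:
`χ(g,ν) = Σ_k Σ_{x} Σ_{ω : 0 → x, |ω| = k} gcTerm g (2d+ν) k ω(·)`.
[cite: BauerschmidtBrydgesSlade2015LogCorr, §1.1 (χ) and Appendix A] -/
theorem susceptibility_eq_tsum_walks (g ν : ℝ) :
    susceptibility d g ν = ∑' k : ℕ, ∑ x ∈ box d k,
      ∑ ω ∈ (zdGraph d).finsetWalkLength k (0 : Site d) x,
        gcTerm g (2 * d + ν) ω.length (fun i => ω.getVert i) := by
  unfold susceptibility survival weightedExpectation
  calc ∫⁻ T in Ioi 0, ENNReal.ofReal (Real.exp (-(2 * d) * T)) *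
        (∑' k : ℕ, ∑ x ∈ box d k, ∑ ω ∈ (zdGraph d).finsetWalkLength k (0 : Site d) x,
          1 * pathIntegral g T ω) * ENNReal.ofReal (Real.exp (-ν * T))
      = ∫⁻ T in Ioi 0, ∑' k : ℕ, ∑ x ∈ box d k, ∑ ω ∈ (zdGraph d).finsetWalkLength k (0 : Site d) x,
          ENNReal.ofReal (Real.exp (-(2 * d) * T)) * pathIntegral g T ω *
            ENNReal.ofReal (Real.exp (-ν * T)) := by
        refine setLIntegral_congr_fun measurableSet_Ioi fun T _ => ?_
        rw [← ENNReal.tsum_mul_left, ← ENNReal.tsum_mul_right]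
        refine tsum_congr fun k => ?_
        rw [Finset.mul_sum, Finset.sum_mul]
        refine Finset.sum_congr rfl fun x _ => ?_
        rw [Finset.mul_sum, Finset.sum_mul]
        refine Finset.sum_congr rfl fun ω _ => ?_
        rw [one_mul]
    _ = ∑' k : ℕ, ∫⁻ T in Ioi 0, ∑ x ∈ box d k, ∑ ω ∈ (zdGraph d).finsetWalkLength k (0 : Site d) x,
          ENNReal.ofReal (Real.exp (-(2 * d) * T)) * pathIntegral g T ω *
            ENNReal.ofReal (Real.exp (-ν * T)) := by
        refine lintegral_tsum fun k => ?_
        exact (Finset.measurable_sum _ fun x _ => Finset.measurable_sum _ fun ω _ =>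
          measurable_pathIntegral_weighted g ν ω).aemeasurable
    _ = ∑' k : ℕ, ∑ x ∈ box d k, ∑ ω ∈ (zdGraph d).finsetWalkLength k (0 : Site d) x,
          ∫⁻ T in Ioi 0, ENNReal.ofReal (Real.exp (-(2 * d) * T)) * pathIntegral g T ω *
            ENNReal.ofReal (Real.exp (-ν * T)) := by
        refine tsum_congr fun k => ?_
        rw [lintegral_finsetSum _ fun x _ => Finset.measurable_sum _ fun ω _ =>
          measurable_pathIntegral_weighted g ν ω]
        refine Finset.sum_congr rfl fun x _ => ?_
        rw [lintegral_finsetSum _ fun ω _ => measurable_pathIntegral_weighted g ν ω]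
    _ = _ := by
        refine tsum_congr fun k => Finset.sum_congr rfl fun x _ => Finset.sum_congr rfl fun ω _ => ?_
        exact lintegral_Ioi_pathIntegral_eq_gcTerm g ν ω

/-- `freeSelfInt` only reads the vertices `v 0, …, v m`. [folklore] -/
theorem freeSelfInt_congr {m : ℕ} {v v' : ℕ → Site d} (h : ∀ i ≤ m, v i = v' i) :
    freeSelfInt m v = freeSelfInt m v' := by
  funext σ
  unfold freeSelfInt
  refine Finset.sum_congr rfl fun i _ => Finset.sum_congr rfl fun j _ => ?_
  rw [h i (Nat.lt_succ_iff.1 i.isLt), h j (Nat.lt_succ_iff.1 j.isLt)]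

/-- `gcTerm` only reads the vertices `v 0, …, v m`. [folklore] -/
theorem gcTerm_congr (g lam : ℝ) {m : ℕ} {v v' : ℕ → Site d} (h : ∀ i ≤ m, v i = v' i) :
    gcTerm g lam m v = gcTerm g lam m v' := by
  unfold gcTerm gcIntegrand
  rw [freeSelfInt_congr h]

/-- **The susceptibility, time-integrated, over step sequences**:
`χ(g,ν) = Σ_k Σ_{e : Fin k → Dir d} gcTerm g (2d+ν) k (pos e)` — the form in which the walk is a
sum over `k` i.i.d. uniform steps and the sojourns are free. [cite: BauerschmidtBrydgesSlade2015LogCorr, §1.1 (χ) and Appendix A] -/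
theorem susceptibility_eq_tsum_stepSeq (g ν : ℝ) :
    susceptibility d g ν = ∑' k : ℕ, ∑ e : SRW.StepSeq d k, gcTerm g (2 * d + ν) k (SRW.pos e) := by
  rw [susceptibility_eq_tsum_walks]
  refine tsum_congr fun k => ?_
  rw [SRW.sum_walks_eq_sum_stepSeq (fun _ ω => gcTerm g (2 * d + ν) ω.length (fun i => ω.getVert i))]
  refine Finset.sum_congr rfl fun e _ => ?_
  rw [SRW.length_toWalk]
  exact gcTerm_congr _ _ fun i hi => SRW.getVert_toWalk e hi

/-! ### The Green function link `C₀(0) = G/(2d)` in `SRW.prob` form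

The identity `∫₀^∞ P(X_T = 0) dT = Σ_m N_m(0) (2d)^{-(m+1)}` is already in the tree as
`greenLintegral_eq_greenSeries` together with `greenSeries_eq_ofReal_tsum` and
`greenZero_eq_toReal` (`WeaklySAWCriticalNuLowerBound.lean`, in `closedWords` / walk-count form),
and transience `Σ_n p_n(0) < ∞` for `d ≥ 3` as `summable_prob_zero`
(`WeaklySAWReturnProbability.lean`, in `card (finsetWalkLength n 0 0)/(2d)^n` form). The three
short corollaries below only transport them to the `Literature.Probability.LatticeModels.SRW.prob`
encoding (`SRW.card_finsetWalkLength_eq_count`) used by the block-decoupling files. -/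

/-- **Transience in `SRW.prob` form**: `Σ_k p_k(0)` converges for `d ≥ 3` — the tree's
`CTWSAW.summable_prob_zero` transported along `SRW.card_finsetWalkLength_eq_count`. [folklore] -/
theorem summable_srw_prob_zero (hd : 3 ≤ d) : Summable fun k => SRW.prob d k 0 := by
  refine (summable_prob_zero (d := d) hd).congr fun n => ?_
  unfold SRW.prob
  rw [SRW.card_finsetWalkLength_eq_count]

/-- **`C₀(0)` in terms of the discrete Green function** (as an `ℝ≥0∞` identity, any `d ≥ 1`):
`∫₀^∞ P(X_T = 0) dT = Σ_k p_k(0) / (2d)` with `p_k(0) = SRW.prob d k 0` — a corollary of the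
tree's `greenLintegral_eq_greenSeries` (the left-hand side is `greenLintegral d` by `rfl`).
[cite: BauerschmidtBrydgesSlade2015LogCorr, §1.2 (C₀(0) = ∫ P(X(T)=0) dT)] -/
theorem lintegral_weightedExpectation_zero_indicator (hd : 0 < d) :
    ∫⁻ T in Ioi 0, weightedExpectation d 0 T (fun x => if x = 0 then 1 else 0) =
      ∑' k : ℕ, ENNReal.ofReal (SRW.prob d k 0 / (2 * d)) := by
  change greenLintegral d = _
  rw [greenLintegral_eq_greenSeries hd, greenSeries]
  refine tsum_congr fun k => ?_
  rw [closedWords_eq_card, SRW.card_finsetWalkLength_eq_count, inv_two_mul_pow_eq_ofReal hd,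
    ← ENNReal.ofReal_natCast, ← ENNReal.ofReal_mul (Nat.cast_nonneg _)]
  congr 1
  unfold SRW.prob
  rw [inv_pow, div_div, ← pow_succ, div_eq_mul_inv]

/-- **`C₀(0) = G/(2d)`** whenever the discrete Green function `G = Σ_k p_k(0)` converges (real
form of the previous identity; the hypothesis holds for every `d ≥ 3` by `summable_srw_prob_zero`,
see `greenZero_eq_tsum_prob`). [cite: BauerschmidtBrydgesSlade2015LogCorr, §1.2 (C₀(0))] -/
theorem greenZero_eq_of_summable (hd : 0 < d) (hs : Summable fun k => SRW.prob d k 0) :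
    greenZero d = (∑' k, SRW.prob d k 0) / (2 * d) := by
  unfold greenZero
  rw [lintegral_weightedExpectation_zero_indicator hd]
  have hnn : ∀ k, 0 ≤ SRW.prob d k 0 / (2 * d) := fun k => by
    have := SRW.prob_nonneg (d := d) k 0; positivity
  rw [← ENNReal.ofReal_tsum_of_nonneg hnn (hs.div_const _), ENNReal.toReal_ofReal
    (tsum_nonneg hnn), tsum_div_const]

/-- **`C₀(0) = Σ_k p_k(0) / (2d)` for `d ≥ 3`.** [cite: BauerschmidtBrydgesSlade2015LogCorr, §1.2 (C₀(0))] -/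
theorem greenZero_eq_tsum_prob (hd : 3 ≤ d) : greenZero d = (∑' k, SRW.prob d k 0) / (2 * d) :=
  greenZero_eq_of_summable (by omega) (summable_srw_prob_zero hd)

end Literature.Barriers.CriticalPhenomena.CTWSAW
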